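import Mathlib
import Literature.MathematicalPhysics.QuantumLattice.FermionGammaFunctorTrace
import Literature.MathematicalPhysics.QuantumLattice.GrassmannGaussianMoments
import HarnessLib

/-!
# Gram expansion of a two-by-two block determinant (stub `stub_marginalRP` of crux
stmt-QuantumFields-9735, line Sketch — algebraic helper file 1)

For square complex blocks `P, Q, J₁, J₂ : Matrix ι ι ℂ` we prove the polynomial identity

  `det [[P, J₁], [J₂, Q]] = Σ_{S,W,Z,T} (-1)^{|S|} ρ(Q)_{S,T} Γ(J₂)_{T,Z} ρ(P)_{Z,W} Γ(J₁)_{W,S}`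

(`det_fromBlocks_eq_sum_rho`), where `Γ(g)_{S,T}` is the minor of `g` (the tree's fermionic
functor `Gamma`) and `ρ(A)_{V,Z}` (`rho`) is the ROW-REPLACEMENT determinant of `A` (rows in `Z`
replaced by unit rows at the columns enumerated by `V`), a polynomial in the entries of `A`
which equals `det A · Γ(A⁻¹)_{V,Z}` for invertible `A` (`rho_eq_det_mul_Gamma_inv`, the tree's
Jacobi identity `det_rowReplace_eq_det_mul_det_inv_submatrix`). For invertible `P, Q` the
identity is Schur's formula, Sylvester's trick and `Tr Γ(g) = det(1+g)`, `Γ(gh) = Γ(g)Γ(h)`;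
the general case follows by density (`eq_of_eqOn_cofinite`). Also: `Γ` of diagonal matrices,
`ρ` of a conjugate transpose and of a diagonally rescaled matrix. All statements are proved.
-/

noncomputable section

open Matrix Complex Finset
open Literature.MathematicalPhysics.QuantumLattice
open scoped ComplexConjugate BigOperators

namespace Summit.QuantumFields.QCD.Theorems.UnquenchedChessboardBoundLine

variable {ι : Type*} [LinearOrder ι] [Fintype ι]

/-! ## Minors of diagonal matrices -/

omit [Fintype ι] in
/-- A product over `Fin k` along the increasing enumeration of `S` is the product over `S`. -/
theorem prod_orderEmbOfFin (S : Finset ι) {k : ℕ} (h : S.card = k) (f : ι → ℂ) :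
    ∏ a : Fin k, f (S.orderEmbOfFin h a) = ∏ i ∈ S, f i := by
  rw [← Finset.prod_coe_sort S]
  exact Fintype.prod_equiv (S.orderIsoOfFin h).toEquiv _ _ fun a => rfl

omit [Fintype ι] in
/-- The minors of a diagonal matrix: `Γ(diag d)_{S,T} = [S = T] ∏_{i ∈ S} d i`. -/
theorem Gamma_diagonal (d : ι → ℂ) (S T : Finset ι) :
    Gamma (diagonal d) S T = if S = T then ∏ i ∈ S, d i else 0 := by
  by_cases hc : S.card = T.card
  · by_cases hST : S = T
    · subst hST
      rw [if_pos rfl, Gamma_apply_of_card_eq _ (k := S.card) rfl rfl]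
      have : (diagonal d).submatrix (S.orderEmbOfFin rfl) (S.orderEmbOfFin rfl) =
          diagonal (d ∘ S.orderEmbOfFin rfl) :=
        submatrix_diagonal_embedding d (S.orderEmbOfFin rfl).toEmbedding
      rw [this, det_diagonal]
      exact prod_orderEmbOfFin S rfl d
    · rw [if_neg hST, Gamma_apply_of_card_eq _ (k := T.card) hc rfl]
      have hnot : ¬ S ⊆ T := fun h => hST (Finset.eq_of_subset_of_card_le h hc.ge)
      obtain ⟨s, hsS, hsT⟩ := Finset.not_subset.1 hnot
      set a : Fin T.card := (S.orderIsoOfFin hc).symm ⟨s, hsS⟩ with ha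
      refine det_eq_zero_of_row_eq_zero a fun b => ?_
      have hsa : S.orderEmbOfFin hc a = s := by
        rw [← Finset.coe_orderIsoOfFin_apply, ha, OrderIso.apply_symm_apply]
      rw [submatrix_apply, hsa, diagonal_apply_ne]
      intro h
      exact hsT (h ▸ Finset.orderEmbOfFin_mem T rfl b)
  · rw [Gamma_apply_of_card_ne _ hc, if_neg]
    rintro rfl
    exact hc rfl

omit [Fintype ι] in
/-- `Γ(-g)_{S,T} = (-1)^{|S|} Γ(g)_{S,T}`. -/
theorem Gamma_neg (g : Matrix ι ι ℂ) (S T : Finset ι) :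
    Gamma (-g) S T = (-1) ^ S.card * Gamma g S T := by
  by_cases hc : S.card = T.card
  · rw [Gamma_apply_of_card_eq _ (k := S.card) rfl hc.symm,
      Gamma_apply_of_card_eq _ (k := S.card) rfl hc.symm]
    rw [show (-g).submatrix (S.orderEmbOfFin rfl) (T.orderEmbOfFin hc.symm) =
        -(g.submatrix (S.orderEmbOfFin rfl) (T.orderEmbOfFin hc.symm)) from rfl, det_neg,
      Fintype.card_fin]
  · rw [Gamma_apply_of_card_ne _ hc, Gamma_apply_of_card_ne _ hc, mul_zero]

/-- `Γ(diag d · g · diag d')_{S,T} = (∏_{S} d) Γ(g)_{S,T} (∏_{T} d')`. -/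
theorem Gamma_diagonal_mul_mul_diagonal (d d' : ι → ℂ) (g : Matrix ι ι ℂ) (S T : Finset ι) :
    Gamma (diagonal d * g * diagonal d') S T = (∏ i ∈ S, d i) * Gamma g S T * ∏ i ∈ T, d' i := by
  rw [Gamma_mul, Gamma_mul, Matrix.mul_apply]
  have h1 : ∀ V, (Gamma (diagonal d) * Gamma g) S V = (∏ i ∈ S, d i) * Gamma g S V := by
    intro V
    rw [Matrix.mul_apply]
    simp_rw [Gamma_diagonal, ite_mul, zero_mul]
    rw [Finset.sum_ite_eq, if_pos (Finset.mem_univ _)]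
  simp_rw [h1, Gamma_diagonal, mul_ite, mul_zero]
  rw [Finset.sum_ite_eq', if_pos (Finset.mem_univ _)]

/-! ## The row-replacement determinant `ρ` -/

omit [Fintype ι] in
/-- The column assigned to a replaced row: the `a`-th element of `Z` goes to the `a`-th element
of `V`. -/
def colOf (V Z : Finset ι) (h : V.card = Z.card) (r : ι) : ι :=
  if hr : r ∈ Z then V.orderEmbOfFin rfl ((Z.orderIsoOfFin h.symm).symm ⟨r, hr⟩) else r

omit [Fintype ι] in
/-- `A` with the rows in `Z` replaced by the unit rows at the columns `colOf V Z`. -/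
def rowRep (A : Matrix ι ι ℂ) (V Z : Finset ι) (h : V.card = Z.card) : Matrix ι ι ℂ :=
  Matrix.of fun r c => if r ∈ Z then (Pi.single (colOf V Z h r) (1 : ℂ) : ι → ℂ) c else A r c

/-- **The row-replacement determinant** `ρ(A)_{V,Z}`: a polynomial in the entries of `A`, equal
to `det A · Γ(A⁻¹)_{V,Z}` for invertible `A`. -/
def rho (A : Matrix ι ι ℂ) (V Z : Finset ι) : ℂ :=
  if h : V.card = Z.card then (rowRep A V Z h).det else 0

omit [Fintype ι] in
/-- `colOf` on the enumeration of `Z`. -/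
theorem colOf_orderEmbOfFin (V Z : Finset ι) (h : V.card = Z.card) (a : Fin V.card) :
    colOf V Z h (Z.orderEmbOfFin h.symm a) = V.orderEmbOfFin rfl a := by
  have hmem : Z.orderEmbOfFin h.symm a ∈ Z := Finset.orderEmbOfFin_mem Z h.symm a
  rw [colOf, dif_pos hmem]
  congr 1
  have : (⟨Z.orderEmbOfFin h.symm a, hmem⟩ : Z) = Z.orderIsoOfFin h.symm a :=
    Subtype.ext (Finset.coe_orderIsoOfFin_apply Z h.symm a).symm
  rw [this, OrderIso.symm_apply_apply]

omit [Fintype ι] in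
/-- The image of the enumeration of `Z` is `Z`. -/
theorem image_orderEmbOfFin_univ (Z : Finset ι) {k : ℕ} (h : Z.card = k) :
    Finset.univ.image (Z.orderEmbOfFin h) = Z := by
  apply Finset.coe_injective
  rw [Finset.coe_image, Finset.coe_univ, Set.image_univ, Finset.range_orderEmbOfFin]

/-- **Jacobi's identity**: `ρ(A)_{V,Z} = det A · Γ(A⁻¹)_{V,Z}` for invertible `A`. -/
theorem rho_eq_det_mul_Gamma_inv {A : Matrix ι ι ℂ} (hA : IsUnit A.det) (V Z : Finset ι) :
    rho A V Z = A.det * Gamma A⁻¹ V Z := by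
  by_cases h : V.card = Z.card
  · rw [rho, dif_pos h, Gamma_apply_of_card_eq _ (k := V.card) rfl h.symm]
    have key := det_rowReplace_eq_det_mul_det_inv_submatrix ℂ A hA
      (i := Z.orderEmbOfFin h.symm) (Z.orderEmbOfFin h.symm).injective (V.orderEmbOfFin rfl)
      (colOf V Z h) (colOf_orderEmbOfFin V Z h)
    rw [image_orderEmbOfFin_univ] at key
    exact key
  · rw [rho, dif_neg h, Gamma_apply_of_card_ne _ h, mul_zero]

/-- `ρ(A)_{V,Z} = 0` unless `|V| = |Z|`. -/
theorem rho_of_card_ne {A : Matrix ι ι ℂ} {V Z : Finset ι} (h : V.card ≠ Z.card) : rho A V Z = 0 := by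
  rw [rho, dif_neg h]

/-! ## Density: cofinitely many shifts `A + t` are invertible -/

/-- The real shifts `t` with `A + t` singular are finitely many (roots of a characteristic
polynomial). -/
theorem finite_setOf_not_isUnit_det_add_smul (A : Matrix ι ι ℂ) :
    {t : ℝ | ¬ IsUnit (A + (t : ℂ) • (1 : Matrix ι ι ℂ)).det}.Finite := by
  have hsub : {t : ℝ | ¬ IsUnit (A + (t : ℂ) • (1 : Matrix ι ι ℂ)).det} ⊆
      (fun t : ℝ => (t : ℂ)) ⁻¹' {z : ℂ | (-A).charpoly.IsRoot z} := by
    intro t ht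
    simp only [Set.mem_setOf_eq, isUnit_iff_ne_zero, not_not] at ht
    simp only [Set.mem_preimage, Set.mem_setOf_eq, Polynomial.IsRoot.def, Matrix.eval_charpoly,
      sub_neg_eq_add]
    rw [Matrix.scalar_apply, ← smul_one_eq_diagonal, add_comm]
    exact ht
  refine Set.Finite.subset (Set.Finite.preimage ?_ ?_) hsub
  · exact Complex.ofReal_injective.injOn
  · exact Polynomial.finite_setOf_isRoot (Matrix.charpoly_monic _).ne_zero

/-- Two continuous functions on `ℝ` that agree off a finite set agree everywhere. -/
theorem eq_of_eqOn_cofinite {f g : ℝ → ℂ} (hf : Continuous f) (hg : Continuous g) {E : Set ℝ}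
    (hE : E.Finite) (h : ∀ t, t ∉ E → f t = g t) : f = g := by
  have hd : Dense (Set.univ \ (hE.toFinset : Set ℝ)) := dense_univ.sdiff_finset hE.toFinset
  refine Continuous.ext_on hd hf hg fun t ht => h t ?_
  intro htE
  exact ht.2 (hE.mem_toFinset.2 htE)

omit [LinearOrder ι] [Fintype ι] in
/-- `t ↦ A + t E` is continuous. -/
theorem continuous_add_smul (A E : Matrix ι ι ℂ) :
    Continuous fun t : ℝ => A + (t : ℂ) • E :=
  continuous_const.add ((Complex.continuous_ofReal.comp continuous_id).smul continuous_const)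

/-- `t ↦ ρ(A + tE)_{V,Z}` is continuous. -/
theorem continuous_rho_add_smul (A E : Matrix ι ι ℂ) (V Z : Finset ι) :
    Continuous fun t : ℝ => rho (A + (t : ℂ) • E) V Z := by
  by_cases h : V.card = Z.card
  · simp only [rho, dif_pos h]
    refine Continuous.matrix_det (continuous_matrix fun r c => ?_)
    simp only [rowRep, Matrix.of_apply]
    split_ifs
    · exact continuous_const
    · exact ((continuous_add_smul A E).matrix_elem r c)
  · simp only [rho, dif_neg h]
    exact continuous_const

/-! ## `ρ` of a conjugate transpose and of a rescaled matrix -/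

/-- `ρ(Aᴴ)_{S,T} = conj ρ(A)_{T,S}`. -/
theorem rho_conjTranspose (A : Matrix ι ι ℂ) (S T : Finset ι) :
    rho Aᴴ S T = conj (rho A T S) := by
  -- both sides as continuous functions of a real shift, equal where `A + t` is invertible
  have hshift : ∀ t : ℝ, (A + (t : ℂ) • (1 : Matrix ι ι ℂ))ᴴ = Aᴴ + (t : ℂ) • 1 := by
    intro t
    rw [conjTranspose_add, conjTranspose_smul, conjTranspose_one, Complex.star_def,
      Complex.conj_ofReal]
  have key : (fun t : ℝ => rho (Aᴴ + (t : ℂ) • 1) S T) =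
      fun t : ℝ => conj (rho (A + (t : ℂ) • 1) T S) := by
    refine eq_of_eqOn_cofinite (continuous_rho_add_smul _ _ _ _)
      (Complex.continuous_conj.comp (continuous_rho_add_smul _ _ _ _))
      (finite_setOf_not_isUnit_det_add_smul A) fun t ht => ?_
    simp only [Set.mem_setOf_eq, not_not] at ht
    set B := A + (t : ℂ) • (1 : Matrix ι ι ℂ) with hB
    have hBh : IsUnit Bᴴ.det := by rw [det_conjTranspose]; exact ht.star
    show rho (Aᴴ + (t : ℂ) • 1) S T = conj (rho B T S)
    rw [← hshift, rho_eq_det_mul_Gamma_inv hBh, rho_eq_det_mul_Gamma_inv ht, det_conjTranspose,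
      ← conjTranspose_nonsing_inv, Gamma_conjTranspose, conjTranspose_apply, map_mul]
    rfl
  have := congrFun key 0
  simpa using this

/-- The inverse of a diagonal matrix with non-zero entries. -/
theorem inv_diagonal_of_ne_zero (v : ι → ℂ) (hv : ∀ i, v i ≠ 0) :
    (diagonal v)⁻¹ = diagonal fun i => (v i)⁻¹ := by
  refine Matrix.inv_eq_left_inv ?_
  rw [diagonal_mul_diagonal, ← diagonal_one]
  congr 1
  funext i
  exact inv_mul_cancel₀ (hv i)

/-- `ρ(diag v · B · diag u)_{V,Z} = (∏ v)(∏ u)(∏_{V} u⁻¹)(∏_{Z} v⁻¹) ρ(B)_{V,Z}` for nowhere-zero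
`v, u`. -/
theorem rho_diagonal_mul_mul_diagonal (v u : ι → ℂ) (hv : ∀ i, v i ≠ 0) (hu : ∀ i, u i ≠ 0)
    (B : Matrix ι ι ℂ) (V Z : Finset ι) :
    rho (diagonal v * B * diagonal u) V Z =
      (∏ i, v i) * (∏ i, u i) * ((∏ s ∈ V, (u s)⁻¹) * (∏ t ∈ Z, (v t)⁻¹) * rho B V Z) := by
  have hshift : ∀ t : ℝ, diagonal v * (B + (t : ℂ) • 1) * diagonal u =
      diagonal v * B * diagonal u + (t : ℂ) • (diagonal v * diagonal u) := by
    intro t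
    rw [Matrix.mul_add, Matrix.add_mul, Matrix.mul_smul, Matrix.smul_mul, Matrix.mul_one]
  have hdv : IsUnit (diagonal v).det := by
    rw [det_diagonal, isUnit_iff_ne_zero]; exact Finset.prod_ne_zero_iff.2 fun i _ => hv i
  have hdu : IsUnit (diagonal u).det := by
    rw [det_diagonal, isUnit_iff_ne_zero]; exact Finset.prod_ne_zero_iff.2 fun i _ => hu i
  have key : (fun t : ℝ => rho (diagonal v * B * diagonal u + (t : ℂ) • (diagonal v * diagonal u)) V Z) =
      fun t : ℝ => (∏ i, v i) * (∏ i, u i) *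
        ((∏ s ∈ V, (u s)⁻¹) * (∏ t ∈ Z, (v t)⁻¹) * rho (B + (t : ℂ) • 1) V Z) := by
    refine eq_of_eqOn_cofinite (continuous_rho_add_smul _ _ _ _)
      (continuous_const.mul (continuous_const.mul (continuous_rho_add_smul _ _ _ _)))
      (finite_setOf_not_isUnit_det_add_smul B) fun t ht => ?_
    simp only [Set.mem_setOf_eq, not_not] at ht
    set C := B + (t : ℂ) • (1 : Matrix ι ι ℂ) with hC
    show rho (diagonal v * B * diagonal u + (t : ℂ) • (diagonal v * diagonal u)) V Z = _
    have hprod : IsUnit (diagonal v * C * diagonal u).det := by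
      rw [det_mul, det_mul]; exact (hdv.mul ht).mul hdu
    rw [← hshift, rho_eq_det_mul_Gamma_inv hprod, rho_eq_det_mul_Gamma_inv ht, det_mul, det_mul,
      Matrix.mul_inv_rev, Matrix.mul_inv_rev, inv_diagonal_of_ne_zero v hv,
      inv_diagonal_of_ne_zero u hu, ← Matrix.mul_assoc, Gamma_diagonal_mul_mul_diagonal,
      det_diagonal, det_diagonal]
    ring
  have := congrFun key 0
  simpa using this

/-! ## The Gram expansion of a block determinant -/

/-- Trace of a fourfold product against a diagonal weight:
`Σ_S d_S (BCDE)_{S,S} = Σ_{S,W,Z,T} d_S B_{S,T} C_{T,Z} D_{Z,W} E_{W,S}`. -/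
theorem sum_diag_mul_mul_mul_apply {κ : Type*} [Fintype κ] (d : κ → ℂ) (B C D E : Matrix κ κ ℂ) :
    ∑ S, d S * (B * C * D * E) S S =
      ∑ S, ∑ W, ∑ Z, ∑ T, d S * B S T * C T Z * D Z W * E W S := by
  refine Finset.sum_congr rfl fun S _ => ?_
  simp only [Matrix.mul_apply, Finset.sum_mul, Finset.mul_sum]
  refine Finset.sum_congr rfl fun W _ => Finset.sum_congr rfl fun Z _ =>
    Finset.sum_congr rfl fun T _ => ?_
  ring

/-- The Gram expansion for invertible diagonal blocks. -/
theorem det_fromBlocks_eq_sum_rho_of_isUnit {P Q : Matrix ι ι ℂ} (hP : IsUnit P.det)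
    (hQ : IsUnit Q.det) (J₁ J₂ : Matrix ι ι ℂ) :
    (fromBlocks P J₁ J₂ Q).det =
      ∑ S : Finset ι, ∑ W : Finset ι, ∑ Z : Finset ι, ∑ T : Finset ι,
        (-1) ^ S.card * rho Q S T * Gamma J₂ T Z * rho P Z W * Gamma J₁ W S := by
  letI : Invertible P := invertibleOfIsUnitDet P hP
  have hQQ : Q - J₂ * ⅟P * J₁ = Q * (1 - Q⁻¹ * J₂ * P⁻¹ * J₁) := by
    rw [Matrix.mul_sub, Matrix.mul_one, ← Matrix.mul_assoc, ← Matrix.mul_assoc,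
      mul_nonsing_inv_cancel_left Q _ hQ, invOf_eq_nonsing_inv]
  rw [det_fromBlocks₁₁, hQQ, det_mul, sub_eq_add_neg, ← trace_Gamma]
  have hneg : -(Q⁻¹ * J₂ * P⁻¹ * J₁) = diagonal (fun _ => (-1 : ℂ)) * (Q⁻¹ * J₂ * P⁻¹ * J₁) := by
    rw [show (diagonal fun _ => (-1 : ℂ)) = -(1 : Matrix ι ι ℂ) by
      rw [← diagonal_one, ← diagonal_neg]]
    rw [neg_mul, one_mul]
  rw [hneg, Gamma_mul, Matrix.trace]
  simp only [Matrix.diag_apply, Matrix.mul_apply (M := Gamma (diagonal fun _ => (-1 : ℂ))),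
    Gamma_diagonal, ite_mul, zero_mul, Finset.sum_ite_eq, Finset.mem_univ, if_true,
    Finset.prod_const]
  rw [Gamma_mul, Gamma_mul, Gamma_mul, sum_diag_mul_mul_mul_apply, Finset.mul_sum, Finset.mul_sum]
  refine Finset.sum_congr rfl fun S _ => ?_
  rw [Finset.mul_sum, Finset.mul_sum]
  refine Finset.sum_congr rfl fun W _ => ?_
  rw [Finset.mul_sum, Finset.mul_sum]
  refine Finset.sum_congr rfl fun Z _ => ?_
  rw [Finset.mul_sum, Finset.mul_sum]
  refine Finset.sum_congr rfl fun T _ => ?_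
  rw [rho_eq_det_mul_Gamma_inv hQ, rho_eq_det_mul_Gamma_inv hP]
  ring

/-- **Gram expansion of a block determinant** (valid for all blocks):
`det [[P, J₁], [J₂, Q]] = Σ_{S,W,Z,T} (-1)^{|S|} ρ(Q)_{S,T} Γ(J₂)_{T,Z} ρ(P)_{Z,W} Γ(J₁)_{W,S}`. -/
theorem det_fromBlocks_eq_sum_rho {κ : Type*} [LinearOrder κ] [Fintype κ]
    (P Q J₁ J₂ : Matrix κ κ ℂ) :
    (fromBlocks P J₁ J₂ Q).det =
      ∑ S : Finset κ, ∑ W : Finset κ, ∑ Z : Finset κ, ∑ T : Finset κ,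
        (-1) ^ S.card * rho Q S T * Gamma J₂ T Z * rho P Z W * Gamma J₁ W S := by
  have hfin : ({t : ℝ | ¬ IsUnit (P + (t : ℂ) • (1 : Matrix κ κ ℂ)).det} ∪
      {t : ℝ | ¬ IsUnit (Q + (t : ℂ) • (1 : Matrix κ κ ℂ)).det}).Finite :=
    (finite_setOf_not_isUnit_det_add_smul P).union (finite_setOf_not_isUnit_det_add_smul Q)
  have key : (fun t : ℝ => (fromBlocks (P + (t : ℂ) • 1) J₁ J₂ (Q + (t : ℂ) • 1)).det) =
      fun t : ℝ => ∑ S : Finset κ, ∑ W : Finset κ, ∑ Z : Finset κ, ∑ T : Finset κ,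
        (-1) ^ S.card * rho (Q + (t : ℂ) • 1) S T * Gamma J₂ T Z * rho (P + (t : ℂ) • 1) Z W *
          Gamma J₁ W S := by
    refine eq_of_eqOn_cofinite ?_ ?_ hfin fun t ht => ?_
    · exact Continuous.matrix_det (Continuous.matrix_fromBlocks (continuous_add_smul P 1)
        continuous_const continuous_const (continuous_add_smul Q 1))
    · refine continuous_finsetSum _ fun S _ => continuous_finsetSum _ fun W _ =>
        continuous_finsetSum _ fun Z _ => continuous_finsetSum _ fun T _ => ?_
      exact (((continuous_const.mul (continuous_rho_add_smul Q 1 S T)).mul continuous_const).mul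
        (continuous_rho_add_smul P 1 Z W)).mul continuous_const
    · simp only [Set.mem_union, Set.mem_setOf_eq, not_or, not_not] at ht
      exact det_fromBlocks_eq_sum_rho_of_isUnit ht.1 ht.2 J₁ J₂
  have := congrFun key 0
  simpa using this

end Summit.QuantumFields.QCD.Theorems.UnquenchedChessboardBoundLine

end
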